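import Mathlib

/-!
# `TwoEndedGram` — kernel check of the algebraic heart of crux idea `entropy-score-ceiling`
(stmt-AtomisticToContinuum-15249). Self-contained (Mathlib only); the statement is copied verbatim
from `Sketch.lean`.
-/

noncomputable section

namespace Summit.AtomisticToContinuum.FouriersLaw.Cruxes.ContactUpperDensity.ScorePairing

open RealInnerProductSpace

variable {E : Type} [NormedAddCommGroup E] [InnerProductSpace ℝ E]

/-- One bath end: Cauchy–Schwarz in the orthogonal complement of the bath momentum `p`. -/
theorem gram_core (s p F : E) (u w τ Φ : ℝ) (hτ : 0 < τ) (hpp : ‖p‖ ^ 2 = τ)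
    (hsF : @inner ℝ E _ s F = u) (hpF : @inner ℝ E _ p F = u) (hsp : @inner ℝ E _ s p = w)
    (hF : ‖F‖ ^ 2 ≤ Φ) :
    u ^ 2 * (τ - w) ^ 2 / τ ^ 2 ≤ (‖s‖ ^ 2 - w ^ 2 / τ) * Φ := by
  set c : ℝ := w / τ with hc
  set d : ℝ := u / τ with hd
  have hps : @inner ℝ E _ p s = w := by rw [real_inner_comm]; exact hsp
  have hFp : @inner ℝ E _ F p = u := by rw [real_inner_comm]; exact hpF
  have hppi : @inner ℝ E _ p p = τ := by rw [real_inner_self_eq_norm_sq]; exact hpp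
  have e1 : @inner ℝ E _ (s - c • p) (F - d • p) = u * (τ - w) / τ := by
    simp only [inner_sub_left, inner_sub_right, real_inner_smul_left, real_inner_smul_right,
      hsF, hsp, hpF, hppi]
    rw [hc, hd]; field_simp; ring
  have e2 : ‖s - c • p‖ ^ 2 = ‖s‖ ^ 2 - w ^ 2 / τ := by
    rw [← real_inner_self_eq_norm_sq, ← real_inner_self_eq_norm_sq]
    simp only [inner_sub_left, inner_sub_right, real_inner_smul_left, real_inner_smul_right,
      hsp, hps, hppi]
    rw [hc]; field_simp; ring
  have e3 : ‖F - d • p‖ ^ 2 = ‖F‖ ^ 2 - u ^ 2 / τ := by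
    rw [← real_inner_self_eq_norm_sq, ← real_inner_self_eq_norm_sq]
    simp only [inner_sub_left, inner_sub_right, real_inner_smul_left, real_inner_smul_right,
      hpF, hFp, hppi]
    rw [hd]; field_simp; ring
  have hcs : |@inner ℝ E _ (s - c • p) (F - d • p)| ≤ ‖s - c • p‖ * ‖F - d • p‖ :=
    abs_real_inner_le_norm _ _
  have hcs2 : (@inner ℝ E _ (s - c • p) (F - d • p)) ^ 2 ≤ ‖s - c • p‖ ^ 2 * ‖F - d • p‖ ^ 2 := by
    have h0 : 0 ≤ ‖s - c • p‖ * ‖F - d • p‖ := by positivity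
    have := sq_le_sq' (by linarith [neg_abs_le (@inner ℝ E _ (s - c • p) (F - d • p)), abs_nonneg (@inner ℝ E _ (s - c • p) (F - d • p))]) (le_trans (le_abs_self _) hcs)
    simpa [mul_pow] using this
  rw [e1, e2, e3] at hcs2
  have hs0 : 0 ≤ ‖s‖ ^ 2 - w ^ 2 / τ := by rw [← e2]; positivity
  have hF' : ‖F‖ ^ 2 - u ^ 2 / τ ≤ Φ := by
    have : 0 ≤ u ^ 2 / τ := by positivity
    linarith
  have key : (u * (τ - w) / τ) ^ 2 = u ^ 2 * (τ - w) ^ 2 / τ ^ 2 := by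
    rw [div_pow, mul_pow]
  calc u ^ 2 * (τ - w) ^ 2 / τ ^ 2 = (u * (τ - w) / τ) ^ 2 := key.symm
    _ ≤ (‖s‖ ^ 2 - w ^ 2 / τ) * (‖F‖ ^ 2 - u ^ 2 / τ) := hcs2
    _ ≤ (‖s‖ ^ 2 - w ^ 2 / τ) * Φ := mul_le_mul_of_nonneg_left hF' hs0

/-- Verbatim copy of `Sketch.TwoEndedGram`. -/
def TwoEndedGram : Prop :=
  ∀ (E : Type) [NormedAddCommGroup E] [InnerProductSpace ℝ E]
    (sL pL FL sR pR FR : E) (J γ TL TR ΦL ΦR : ℝ),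
    0 < γ → 0 < TR → TR < TL → 0 ≤ J → 0 < TL - J / γ →
    0 < ΦL → 0 < ΦR → ‖FL‖ ^ 2 ≤ ΦL → ‖FR‖ ^ 2 ≤ ΦR →
    @inner ℝ E _ sL FL = J → @inner ℝ E _ sR FR = -J →
    @inner ℝ E _ pL FL = J → @inner ℝ E _ pR FR = -J →
    @inner ℝ E _ sL pL = -(J / γ) → @inner ℝ E _ sR pR = J / γ →
    ‖pL‖ ^ 2 = TL - J / γ → ‖pR‖ ^ 2 = TR + J / γ →
    γ / TL * ‖sL‖ ^ 2 + γ / TR * ‖sR‖ ^ 2 ≤ J * (1 / TR - 1 / TL) →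
    J ≤ (TL - TR) / (TL * TR *
      (γ * TL / ((TL - J / γ) ^ 2 * ΦL) + 1 / (γ * TL * (TL - J / γ)) +
        γ * TR / ((TR + J / γ) ^ 2 * ΦR) + 1 / (γ * TR * (TR + J / γ))))

theorem twoEndedGram : TwoEndedGram := by
  intro E _ _ sL pL FL sR pR FR J γ TL TR ΦL ΦR hγ hTR hTLR hJ hτL hΦL hΦR hFL hFR
    hsFL hsFR hpFL hpFR hspL hspR hppL hppR hbudget
  have hTL : 0 < TL := lt_trans hTR hTLR
  set τL : ℝ := TL - J / γ with hτLdef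
  set τR : ℝ := TR + J / γ with hτRdef
  have hτR : 0 < τR := by have : 0 ≤ J / γ := by positivity
                          linarith
  -- per-end Gram bounds
  have AL := gram_core sL pL FL J (-(J / γ)) τL ΦL hτL hppL hsFL hpFL hspL hFL
  have AR := gram_core sR pR FR (-J) (J / γ) τR ΦR hτR hppR hsFR hpFR hspR hFR
  -- simplify the numerators: τL - (-(J/γ)) = TL, τR - J/γ = TR
  have nL : τL - -(J / γ) = TL := by rw [hτLdef]; ring
  have nR : τR - J / γ = TR := by rw [hτRdef]; ring
  rw [nL] at AL
  rw [nR] at AR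
  -- lower bounds on ‖s_b‖²
  have aL : J ^ 2 * TL ^ 2 / (τL ^ 2 * ΦL) + J ^ 2 / (γ ^ 2 * τL) ≤ ‖sL‖ ^ 2 := by
    have h1 : J ^ 2 * TL ^ 2 / τL ^ 2 ≤ (‖sL‖ ^ 2 - (-(J / γ)) ^ 2 / τL) * ΦL := AL
    have h2 : J ^ 2 * TL ^ 2 / (τL ^ 2 * ΦL) ≤ ‖sL‖ ^ 2 - (-(J / γ)) ^ 2 / τL := by
      rw [div_le_iff₀ (by positivity)]
      calc J ^ 2 * TL ^ 2 = J ^ 2 * TL ^ 2 / τL ^ 2 * τL ^ 2 := by field_simp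
        _ ≤ (‖sL‖ ^ 2 - (-(J / γ)) ^ 2 / τL) * ΦL * τL ^ 2 :=
            mul_le_mul_of_nonneg_right h1 (by positivity)
        _ = (‖sL‖ ^ 2 - (-(J / γ)) ^ 2 / τL) * (τL ^ 2 * ΦL) := by ring
    have h3 : (-(J / γ)) ^ 2 / τL = J ^ 2 / (γ ^ 2 * τL) := by
      rw [neg_pow_two, div_pow]; field_simp
    linarith [h2, h3.symm.le, h3.le]
  have aR : J ^ 2 * TR ^ 2 / (τR ^ 2 * ΦR) + J ^ 2 / (γ ^ 2 * τR) ≤ ‖sR‖ ^ 2 := by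
    have h1 : (-J) ^ 2 * TR ^ 2 / τR ^ 2 ≤ (‖sR‖ ^ 2 - (J / γ) ^ 2 / τR) * ΦR := AR
    rw [neg_pow_two] at h1
    have h2 : J ^ 2 * TR ^ 2 / (τR ^ 2 * ΦR) ≤ ‖sR‖ ^ 2 - (J / γ) ^ 2 / τR := by
      rw [div_le_iff₀ (by positivity)]
      calc J ^ 2 * TR ^ 2 = J ^ 2 * TR ^ 2 / τR ^ 2 * τR ^ 2 := by field_simp
        _ ≤ (‖sR‖ ^ 2 - (J / γ) ^ 2 / τR) * ΦR * τR ^ 2 :=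
            mul_le_mul_of_nonneg_right h1 (by positivity)
        _ = (‖sR‖ ^ 2 - (J / γ) ^ 2 / τR) * (τR ^ 2 * ΦR) := by ring
    have h3 : (J / γ) ^ 2 / τR = J ^ 2 / (γ ^ 2 * τR) := by
      rw [div_pow]; field_simp
    linarith [h2, h3.symm.le, h3.le]
  -- the sum S and the budget
  set S : ℝ := γ * TL / (τL ^ 2 * ΦL) + 1 / (γ * TL * τL) +
      γ * TR / (τR ^ 2 * ΦR) + 1 / (γ * TR * τR) with hS
  have hSpos : 0 < S := by positivity
  have main : J ^ 2 * S ≤ J * (1 / TR - 1 / TL) := by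
    have eL : γ / TL * (J ^ 2 * TL ^ 2 / (τL ^ 2 * ΦL) + J ^ 2 / (γ ^ 2 * τL)) =
        J ^ 2 * (γ * TL / (τL ^ 2 * ΦL) + 1 / (γ * TL * τL)) := by
      field_simp
    have eR : γ / TR * (J ^ 2 * TR ^ 2 / (τR ^ 2 * ΦR) + J ^ 2 / (γ ^ 2 * τR)) =
        J ^ 2 * (γ * TR / (τR ^ 2 * ΦR) + 1 / (γ * TR * τR)) := by
      field_simp
    have bL : γ / TL * (J ^ 2 * TL ^ 2 / (τL ^ 2 * ΦL) + J ^ 2 / (γ ^ 2 * τL)) ≤ γ / TL * ‖sL‖ ^ 2 :=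
      mul_le_mul_of_nonneg_left aL (by positivity)
    have bR : γ / TR * (J ^ 2 * TR ^ 2 / (τR ^ 2 * ΦR) + J ^ 2 / (γ ^ 2 * τR)) ≤ γ / TR * ‖sR‖ ^ 2 :=
      mul_le_mul_of_nonneg_left aR (by positivity)
    have : J ^ 2 * S = J ^ 2 * (γ * TL / (τL ^ 2 * ΦL) + 1 / (γ * TL * τL)) +
        J ^ 2 * (γ * TR / (τR ^ 2 * ΦR) + 1 / (γ * TR * τR)) := by rw [hS]; ring
    linarith [bL, bR, hbudget, eL, eR, this]
  -- conclude
  have goal : J ≤ (TL - TR) / (TL * TR * S) := by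
    rw [le_div_iff₀ (by positivity)]
    rcases hJ.eq_or_lt with hJ0 | hJpos
    · rw [← hJ0]; simp; linarith
    · have h1 : J * S ≤ 1 / TR - 1 / TL := by
        have := main
        have hJS : J * (J * S) ≤ J * (1 / TR - 1 / TL) := by nlinarith [this]
        exact le_of_mul_le_mul_left hJS hJpos
      have h2 : 1 / TR - 1 / TL = (TL - TR) / (TL * TR) := by field_simp
      rw [h2] at h1
      have h3 : J * S * (TL * TR) ≤ TL - TR := by
        have := mul_le_mul_of_nonneg_right h1 (by positivity : (0:ℝ) ≤ TL * TR)
        rwa [div_mul_cancel₀ _ (by positivity : TL * TR ≠ 0)] at this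
      calc J * (TL * TR * S) = J * S * (TL * TR) := by ring
        _ ≤ TL - TR := h3
  simpa [hS, hτLdef, hτRdef] using goal

end Summit.AtomisticToContinuum.FouriersLaw.Cruxes.ContactUpperDensity.ScorePairing

end
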